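import Mathlib
import Summits.ResolutionOfSingularities.ResolutionOfSingularities.Theorems.RadicialJungCleanModelsCleanCurveTauTwoSlice
import Summits.ResolutionOfSingularities.ResolutionOfSingularities.Theorems.RadicialJungCleanModelsCleanDimTwoSlice
import Summits.ResolutionOfSingularities.ResolutionOfSingularities.Theorems.RadicialJungCleanModelsCleanPermissibleSeq
import Summits.ResolutionOfSingularities.ResolutionOfSingularities.Theorems.FrobeniusLadderFInjectiveMacaulayficationProp44Invariants
import Summits.ResolutionOfSingularities.ResolutionOfSingularities.Theorems.FrobeniusLadderFInjectiveMacaulayficationProp44InvariantsDim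
import Summits.ResolutionOfSingularities.ResolutionOfSingularities.Theorems.FrobeniusLadderFInjectiveMacaulayficationProp44OfOrderReducible
import HarnessLib

/-!
# Route `RadicialJung`, crux `CleanModels` (stmt-ResolutionOfSingularities-15917), line `Sketch` rev 35, stub 6 `stub_cleanProp44` (X44c):
# THE CLEAN ASSEMBLY, SECOND CUT — X44c from the `τ = 1` residual only (clean reach-tidy, clean `τ = 1` point slice, clean curve slice THROUGH A `τ = 1` POINT)

Refinement of ✓ `cleanProp44_of_cleanPieces` (`…CleanProp44OfPieces.lean`, p820601) after ✓ `exists_isCleanPermissibleSeq_lt_comap_of_curve_two_le_tau`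
(`…CleanCurveTauTwoSlice.lean`): the regular-curve pieces whose closed points all have Hironaka `τ ≥ 2` are now settled in the kernel (no births over `τ ≥ 2`
points), so the curve hypothesis shrinks to curves carrying a CLOSED point with `τ = 1` — the clean twin of the tree's split in
✓ `CP2008Prop44.cossartPiltant2008_prop44_holds` (`orderReducible_comap_of_curve_two_le_tau` vs `stub_curve` with `hτ1`).

* `cleanProp44_of_tauOnePieces` — **`hreach → htauOne → hcurveTauOne →` the statement of `stub_cleanProp44` VERBATIM**, where `hcurveTauOne` has the
  binders of ✓ `CP2008Prop44.stub_curve` (with `hτ1 : ¬ ∀ y ∈ Y, IsClosed {y} → τ_y ≥ 2`) plus the clean data, and the two other hypotheses are those of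
  `cleanProp44_of_cleanPieces`.

So the research residual of X44c (= stub 6 of the skeleton) is, in kernel form: CLEAN REACH-TIDY (its Phase I = point steps is mechanical; Phase II blows up
intersecting curves of `Σ`), the CLEAN `τ = 1` ISOLATED-POINT SLICE, and the CLEAN CURVE SLICE THROUGH A `τ = 1` POINT — the three places where the
births (B′)/(B5′) of memo 4e §2.4–2.6 can occur.

Honest framing: OURS; the three hypotheses are NOT proved here; nothing here proves X44c, any case of `CleanModels`, or resolution in characteristic `p`.
-/
noncomputable section

set_option linter.dupNamespace false -- mandated namespace of this single-conjunct summit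

open CategoryTheory CategoryTheory.Limits AlgebraicGeometry TopologicalSpace IsLocalRing
open Literature.AlgebraicGeometry.Resolution Literature.AlgebraicGeometry.Motives
open Scheme.IdealSheafData

namespace Summit.ResolutionOfSingularities.ResolutionOfSingularities.Theorems.RadicialJung.CleanModels

/-- In the situation of `exists_isCleanPermissibleSeq_lt_of_pieces`: a point of order `≥ m` lies in `Z i` or outside `V i`. [folklore] -/
private theorem mem_or_not_mem_of_cover {X : Scheme.{0}} {J : X.IdealSheafData} {m : ℕ} {n : ℕ} {Z : Fin n → Set X}
    (hcov : ∀ z : X, (m : ℕ∞) ≤ idealOrder J z → ∃ i, z ∈ Z i) (i : Fin n) (V : X.Opens)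
    (hV : (V : Set X) = (⋃ j ∈ {j : Fin n | j ≠ i}, Z j)ᶜ) (z : X) (hz : (m : ℕ∞) ≤ idealOrder J z) :
    z ∈ Z i ∨ z ∉ (V : Set X) := by
  obtain ⟨j, hj⟩ := hcov z hz
  by_cases hji : j = i
  · exact Or.inl (hji ▸ hj)
  · right
    rw [hV, Set.mem_compl_iff, not_not]
    exact Set.mem_iUnion₂.mpr ⟨j, hji, hj⟩

/-- A piece contained in `V i`. [folklore] -/
private theorem subset_of_cover {X : Scheme.{0}} {n : ℕ} {Z : Fin n → Set X} (hdisj : ∀ i j, i ≠ j → Disjoint (Z i) (Z j))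
    (i : Fin n) (V : X.Opens) (hV : (V : Set X) = (⋃ j ∈ {j : Fin n | j ≠ i}, Z j)ᶜ) : Z i ⊆ (V : Set X) := by
  intro z hz
  rw [hV, Set.mem_compl_iff, Set.mem_iUnion₂]
  rintro ⟨j, hj, hzj⟩
  exact Set.disjoint_left.mp (hdisj i j (Ne.symm hj)) hz hzj

set_option maxHeartbeats 800000 in
-- the binder lists of the three hypotheses and of X44c are long (as in the tree's `cossartPiltant2008_prop44_holds`)
/-- **THE CLEAN ASSEMBLY, SECOND CUT: X44c (`stub_cleanProp44`, verbatim) from clean reach-tidy, the clean `τ = 1` isolated-point slice and the clean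
regular-curve slice THROUGH A `τ = 1` POINT.**  See the module docstring. [cite: CossartPiltant2008, Prop. 4.4] [cite: Piltant2013, Prop. 5.1 (proof, Step 2)] -/
theorem cleanProp44_of_tauOnePieces
    (hreach : ∀ (p : ℕ), p.Prime → ∀ {X : Scheme.{0}} [IsIntegral X] [IsNoetherian X], CharP X.functionField p →
      ∀ (hX : Scheme.IsRegular X), Scheme.IsQuasiExcellent X → topologicalKrullDim X ≤ 3 →
      ∀ (G : X.functionField), (∀ x : X, CleanRegAt p (algebraMap (X.presheaf.stalk x) X.functionField) G) →
      ∀ (J : X.IdealSheafData) {μ : ℕ}, 1 ≤ μ → (∀ z, idealOrder J z ≤ μ) → (∀ z ∈ J.support, 1 < Order.coheight z) →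
      ∃ (X₁ : Scheme.{0}) (Φ : X₁ ⟶ X) (_ : IsIntegral X₁) (_ : IsDominant Φ) (J₁ : X₁.IdealSheafData)
        (_ : IsCleanPermissibleSeq p Φ J μ J₁ G) (n : ℕ) (Z : Fin n → Set X₁),
        (∀ i, IsClosed (Z i)) ∧ (∀ i j, i ≠ j → Disjoint (Z i) (Z j)) ∧
        (∀ z : X₁, (μ : ℕ∞) ≤ idealOrder J₁ z → ∃ i, z ∈ Z i) ∧
        ∀ i, (∃ x : X₁, Z i = {x} ∧ idealOrder J₁ x = μ ∧ (maximalIdeal (X₁.presheaf.stalk x)).spanFinrank = 3 ∧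
                ∀ hr : IsRegularLocalRing (X₁.presheaf.stalk x), 2 ≤ @stalkTau X₁ J₁ x hr μ) ∨
             (∃ x : X₁, Z i = {x} ∧ idealOrder J₁ x = μ ∧ (maximalIdeal (X₁.presheaf.stalk x)).spanFinrank = 3 ∧
                ∀ hr : IsRegularLocalRing (X₁.presheaf.stalk x), @stalkTau X₁ J₁ x hr μ = 1) ∨
             (∃ x : X₁, Z i = {x} ∧ idealOrder J₁ x = μ ∧ Order.coheight x = 2) ∨
             (∃ Y : Closeds X₁, Z i = (Y : Set X₁) ∧ Scheme.IsRegular (vanishingIdeal Y).subscheme ∧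
                IsIrreducible (Y : Set X₁) ∧ (∀ y ∈ (Y : Set X₁), idealOrder J₁ y = μ) ∧
                ∀ y ∈ (Y : Set X₁), ∀ hr : IsRegularLocalRing (X₁.presheaf.stalk y),
                  ∃ c : Fin 2 → X₁.presheaf.stalk y, @IsRsopPart _ _ _ 2 c ∧
                    Ideal.span (Set.range c) = stalkIdeal (vanishingIdeal Y) y))
    (htauOne : ∀ (p : ℕ), p.Prime → ∀ {X : Scheme.{0}} [IsIntegral X] [IsNoetherian X], CharP X.functionField p →
      ∀ (hX : Scheme.IsRegular X), Scheme.IsQuasiExcellent X → topologicalKrullDim X ≤ 3 →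
      ∀ (G : X.functionField), (∀ x : X, CleanRegAt p (algebraMap (X.presheaf.stalk x) X.functionField) G) →
      ∀ (J : X.IdealSheafData) {m : ℕ}, 1 ≤ m → (∀ z, idealOrder J z ≤ m) → (∀ z ∈ J.support, 1 < Order.coheight z) →
      ∀ (V : X.Opens) (x : X), x ∈ V → ∀ (hcl : IsClosed ({x} : Set X)),
      (∀ z : X, (m : ℕ∞) ≤ idealOrder J z → z = x ∨ z ∉ (V : Set X)) → idealOrder J x = m →
      (maximalIdeal (X.presheaf.stalk x)).spanFinrank = 3 → (haveI := hX x; stalkTau J x m = 1) → IsGRing (X.presheaf.stalk x) →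
      ∀ [IsIntegral ((V : X.Opens) : Scheme.{0})] [IsDominant V.ι],
      ∃ (V' : Scheme.{0}) (π : V' ⟶ V) (_ : IsIntegral V') (_ : IsDominant π) (K' : V'.IdealSheafData),
        IsCleanPermissibleSeq p π (J.comap V.ι) m K' (RatFn.functionFieldMap V.ι G) ∧ ∀ y, idealOrder K' y < m)
    (hcurveTauOne : ∀ (p : ℕ), p.Prime → ∀ {X : Scheme.{0}} [IsIntegral X] [IsNoetherian X], CharP X.functionField p →
      ∀ (hX : Scheme.IsRegular X), Scheme.IsQuasiExcellent X → topologicalKrullDim X ≤ 3 →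
      ∀ (G : X.functionField), (∀ x : X, CleanRegAt p (algebraMap (X.presheaf.stalk x) X.functionField) G) →
      ∀ (J : X.IdealSheafData) {m : ℕ}, 1 ≤ m → (∀ z, idealOrder J z ≤ m) → (∀ z ∈ J.support, 1 < Order.coheight z) →
      ∀ (V : X.Opens) (Y : Closeds X), Scheme.IsRegular (vanishingIdeal Y).subscheme → IsIrreducible (Y : Set X) →
      (Y : Set X) ⊆ (V : Set X) → (∀ z : X, (m : ℕ∞) ≤ idealOrder J z → z ∈ (Y : Set X) ∨ z ∉ (V : Set X)) →
      (∀ y ∈ (Y : Set X), idealOrder J y = m) →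
      (∀ y ∈ (Y : Set X), haveI := hX y; ∃ c : Fin 2 → X.presheaf.stalk y, IsRsopPart c ∧
        Ideal.span (Set.range c) = stalkIdeal (vanishingIdeal Y) y) →
      (¬ ∀ y ∈ (Y : Set X), IsClosed ({y} : Set X) → haveI := hX y; 2 ≤ stalkTau J y m) →
      ∀ [IsIntegral ((V : X.Opens) : Scheme.{0})] [IsDominant V.ι],
      ∃ (V' : Scheme.{0}) (π : V' ⟶ V) (_ : IsIntegral V') (_ : IsDominant π) (K' : V'.IdealSheafData),
        IsCleanPermissibleSeq p π (J.comap V.ι) m K' (RatFn.functionFieldMap V.ι G) ∧ ∀ y, idealOrder K' y < m) :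
    ∀ (p : ℕ), p.Prime → ∀ (S : Scheme.{0}) [IsIntegral S] [IsNoetherian S],
      CharP S.functionField p → Scheme.IsRegular S → Scheme.IsExcellent S → topologicalKrullDim S = 3 →
      ∀ G₀ : S.functionField, (∀ s : S, CleanRegAt p (algebraMap (S.presheaf.stalk s) S.functionField) G₀) →
      ∀ I : S.IdealSheafData, I ≠ ⊥ →
      ∀ (X : Scheme.{0}) (ρ : X ⟶ S) [IsIntegral X] [IsNoetherian X] [IsDominant ρ],
        IsCleanRegularCentreBlowupSeq p ρ I G₀ →
        (∀ x : X, CleanRegAt p (algebraMap (X.presheaf.stalk x) X.functionField) (RatFn.functionFieldMap ρ G₀)) →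
        ∀ (J : X.IdealSheafData) (μ : ℕ), 1 ≤ μ →
          (∀ x ∈ J.support, 1 < Order.coheight x) → (∀ x, idealOrder J x ≤ μ) → (∃ x, idealOrder J x = μ) →
          ∃ (X' : Scheme.{0}) (π : X' ⟶ X) (_ : IsIntegral X') (_ : IsDominant π) (J' : X'.IdealSheafData),
            IsCleanPermissibleSeq p π J μ J' (RatFn.functionFieldMap ρ G₀) ∧ ∀ x, idealOrder J' x < μ := by
  intro p hp S _ _ hchar hS hexc hdimS G₀ _ I _ X ρ _ _ _ hρ hG J μ hμ hcodim hle _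
  have hρ' : IsRegularCentreBlowupSeq ρ I := hρ.isRegularCentreBlowupSeq
  have hX : Scheme.IsRegular X := hρ'.isRegular hS
  have hqe : Scheme.IsQuasiExcellent X := hρ'.isQuasiExcellent hexc
  have hX3 : topologicalKrullDim X ≤ 3 := CP2008Prop44.topologicalKrullDim_stage_le hρ' inferInstance (n := 3) hdimS.le
  haveI hcharX : CharP X.functionField p := charP_of_injective_ringHom (RatFn.functionFieldMap ρ).injective p
  set G : X.functionField := RatFn.functionFieldMap ρ G₀ with hGdef
  -- reach a tidy stage by a CLEAN-permissible sequence
  obtain ⟨X₁, Φ, hint₁', hΦ, J₁, hseq, n, Z, hZc, hdisj, hcov, hkind⟩ := hreach p hp hcharX hX hqe hX3 G hG J hμ hle hcodim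
  haveI := hint₁'
  haveI := hΦ
  -- the invariants at the tidy stage (over the forgetful map to the W4.6 currency)
  have hseqW : CampaignW46.IsPermissibleBlowupSeq J μ Φ J₁ :=
    CP2008Prop44.isPermissibleBlowupSeq_of_isPermissibleSeq hseq.isPermissibleSeq
  obtain ⟨-, hnoeth₁, hX₁, hqe₁, hle₁, hcodim₁, hG₁⟩ :=
    CP2008Prop44.prop44Invariants_stage S hS hexc I X ρ hρ' J μ hμ hcodim hle hseqW
  have hX3₁ : topologicalKrullDim X₁ ≤ 3 := CP2008Prop44.prop44Invariants_stage_dim hρ' (n := 3) hdimS.le hseqW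
  haveI := hnoeth₁
  haveI hcharX₁ : CharP X₁.functionField p := charP_of_injective_ringHom (RatFn.functionFieldMap Φ).injective p
  -- the line stays clean-regular at every point of the tidy stage
  have hG₁' : ∀ x : X₁, CleanRegAt p (algebraMap (X₁.presheaf.stalk x) X₁.functionField) (RatFn.functionFieldMap Φ G) :=
    hseq.cleanRegAt hp hcharX hG
  -- settle each piece relative to the complement of the others, and patch
  have hred : ∃ (X' : Scheme.{0}) (π : X' ⟶ X₁) (_ : IsIntegral X') (_ : IsDominant π) (J' : X'.IdealSheafData),
      IsCleanPermissibleSeq p π J₁ μ J' (RatFn.functionFieldMap Φ G) ∧ ∀ x, idealOrder J' x < μ := by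
    refine exists_isCleanPermissibleSeq_lt_of_pieces J₁ μ (RatFn.functionFieldMap Φ G) Z hZc hdisj hcov fun i V hV => ?_
    intro hVint hVdom
    have hbad := mem_or_not_mem_of_cover hcov i V hV
    have hZV := subset_of_cover hdisj i V hV
    rcases hkind i with ⟨x, hZ, hord, hdim, hτ⟩ | ⟨x, hZ, hord, hdim, hτ⟩ | ⟨x, hZ, hord, hcoh⟩ | ⟨Y, hZ, hreg, hirr, hordY, hcurveY⟩
    · -- τ ≥ 2 threefold point: the CLEAN isolated τ ≥ 2 branch (✓ `…CleanTauTwoSlice`)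
      have hxV : x ∈ V := hZV (by rw [hZ]; exact Set.mem_singleton x)
      have hcl : IsClosed ({x} : Set X₁) := hZ ▸ hZc i
      exact exists_isCleanPermissibleSeq_lt_comap_of_isolated_two_le_tau hp hX₁ J₁ hμ (RatFn.functionFieldMap Φ G) hG₁' V x hxV hcl
        (fun z hz => (hbad z hz).imp (fun h => by rw [hZ] at h; exact h) id) hord hdim (hτ (hX₁ x)) (hG₁ x)
    · -- τ = 1 threefold point: HYPOTHESIS `htauOne`
      have hxV : x ∈ V := hZV (by rw [hZ]; exact Set.mem_singleton x)
      have hcl : IsClosed ({x} : Set X₁) := hZ ▸ hZc i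
      exact htauOne p hp hcharX₁ hX₁ hqe₁ hX3₁ (RatFn.functionFieldMap Φ G) hG₁' J₁ hμ hle₁ hcodim₁ V x hxV hcl
        (fun z hz => (hbad z hz).imp (fun h => by rw [hZ] at h; exact h) id) hord hdim (hτ (hX₁ x)) (hG₁ x)
    · -- coheight-2 point: the CLEAN local-dimension-two branch (✓ `…CleanDimTwoSlice`)
      have hxV : x ∈ V := hZV (by rw [hZ]; exact Set.mem_singleton x)
      have hcl : IsClosed ({x} : Set X₁) := hZ ▸ hZc i
      exact exists_isCleanPermissibleSeq_lt_comap_of_isolated_coheight_two hp hX₁ J₁ hμ hle₁ hcodim₁ (RatFn.functionFieldMap Φ G) hG₁'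
        V x hxV hcl (fun z hz => (hbad z hz).imp (fun h => by rw [hZ] at h; exact h) id) hord hcoh
    · -- regular curve: τ ≥ 2 at the closed points ⇒ the CLEAN τ ≥ 2 curve slice (✓ `…CleanCurveTauTwoSlice`); else HYPOTHESIS `hcurveTauOne`
      by_cases hall : ∀ y ∈ (Y : Set X₁), IsClosed ({y} : Set X₁) → haveI := hX₁ y; 2 ≤ stalkTau J₁ y μ
      · exact exists_isCleanPermissibleSeq_lt_comap_of_curve_two_le_tau hp hX₁ hqe₁ hX3₁ (RatFn.functionFieldMap Φ G) hG₁' J₁ hμ hle₁ V Y hirr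
          (hZ ▸ hZV) (fun z hz => (hbad z hz).imp (fun h => by rw [hZ] at h; exact h) id) hordY (fun y hy => hcurveY y hy (hX₁ y)) hall
      · exact hcurveTauOne p hp hcharX₁ hX₁ hqe₁ hX3₁ (RatFn.functionFieldMap Φ G) hG₁' J₁ hμ hle₁ hcodim₁ V Y hreg hirr (hZ ▸ hZV)
          (fun z hz => (hbad z hz).imp (fun h => by rw [hZ] at h; exact h) id) hordY (fun y hy => hcurveY y hy (hX₁ y)) hall
  -- compose with the reach sequence
  obtain ⟨X', π, hX', hπ, J', hseq', hlt⟩ := hred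
  haveI := hX'
  haveI := hπ
  exact ⟨X', π ≫ Φ, inferInstance, inferInstance, J', hseq.comp hseq' rfl, hlt⟩

end Summit.ResolutionOfSingularities.ResolutionOfSingularities.Theorems.RadicialJung.CleanModels

end
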